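import Summits.BirchSwinnertonDyer.Rank1Residual.ManinAdditive.WildThreeEdgeLaws
import Literature.NumberTheory.EllipticCurves.IsogenyNeronScalingIndexProofs
import Summits.BirchSwinnertonDyer.BirchSwinnertonDyer.Theorems.ManinLocalTwoThreeWildThreeTorsionAscent
import Summits.BirchSwinnertonDyer.BirchSwinnertonDyer.Theorems.ManinLocalTwoThreeManinPrimeToAdditiveFiveLeDegreeUpSevenOfOrdinaryTwistLaw
import Literature.NumberTheory.EllipticCurves.IsogenyNeronScalingMinimalDiscriminantDirectionProofs
import Literature.NumberTheory.EllipticCurves.NeronIsogenyScalingHoldsProofs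
import Literature.NumberTheory.EllipticCurves.ComplexPeriod
import HarnessLib
import HarnessLib.Audit.Tags

/-!
# E-an-97 `ThreeIsogenyCovolumeLawAtWildThree` IS A THEOREM — the `3`-isogeny Néron-covolume law at wild `3`
# (cell `bsd-f2-manin`, crux C3 `ManinPrimeToThreeAtNine` stmt-BirchSwinnertonDyer-22968, an's THEOREM TARGET of
# `WildThreeEdgeLaws.lean` §2, MEMO-an §63.3; C2/C3 LEAD `bsd-line-manin23-p1` gen 8)

Summit `BirchSwinnertonDyer`, route `ManinLocalTwoThree`.  The typed row E-an-97
`Summit.BirchSwinnertonDyer.Rank1Residual.ManinAdditive.WildThreeEdges.ThreeIsogenyCovolumeLawAtWildThree`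
(typer gen 12, VERBATIM from an's Sketch-an-g21; REF1 §R63: «THEOREM on paper, re-derived») is discharged here BY NAME,
with no named fact and no law: for a rational isogeny `φ : W → W₂` of degree `3` between globally minimal curves with
`27 ∣ N(W)` and Néron period pairs `L, L₂`,
`ord₃ Δ_min(W) < ord₃ Δ_min(W₂) ⟹ covol(Λ_{W₂}) = covol(Λ_W) / 3` and
`ord₃ Δ_min(W₂) < ord₃ Δ_min(W) ⟹ covol(Λ_{W₂}) = 3 · covol(Λ_W)`.

## Proof (assembly of tree theorems)

1. NÉRON SCALAR WITH INDEX (Literature `WeierstrassCurve.Isogeny.exists_int_neronScaling_relIndex_eq_degree`,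
   `IsogenyNeronScalingIndexProofs` — re-homed there by the cell typer (T-p1-g8-1) so that this file stays outside route
   `TameQuarticManinParity`'s Theses cone; Silverman *AEC* VI.4.1(b) + Galois descent + integral Néron scaling): `n ∈ ℤ`
   with `nΛ_W ⊆ Λ_{W₂}` and `[Λ_{W₂} : nΛ_W] = deg φ = 3`.
2. `n ∣ 3` (`exists_int_eq_and_dvd_of_neronScaling`: `3Λ_{W₂} ⊆ nΛ_W` from the index, so `(3/n)Λ_{W₂} ⊆ Λ_W` is an
   integral Néron scaling; Dokchitser–Dokchitser Lemma 10: `a a' = p`).  Hence `n = ±1` or `n = ±3`.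
3. `27 ∣ N(W)` ⟹ no `Iₙ*` fibre at `3` (`not_cube_dvd_conductorNorm_of_kodairaSymbolAt_eq_Istar`, Ogg: `f₃(Iₙ*) = 2`)
   and `W` additive at `3` (`9 ∣ N(W)`), so `0 ≤ ord₃ j(W)` (`padicValRat_j_nonneg_of_forall_ne_Istar_placeOf`:
   potentially multiplicative additive curves are `Iₙ*`).
4. DIRECTION (Gealy–Klagsbrun 2017 Prop. 2.1 + Cor. 3.2, tree theorem
   `dvd_and_not_dvd_neronScaling_of_padicValInt_minimalDiscriminantInt_lt_of_relIndex_eq`, valid at every potentially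
   good `p`): a RISE of `ord₃ Δ_min` along `z ↦ nz` forces `3 ∤ n` (so `n = ±1`), a DROP forces `3 ∥ n` (so `n = ±3`).
5. COVOLUMES (Mathlib `ZLattice.covolume_div_covolume_eq_relIndex'`, tree `PeriodPair.covolume_mulLeft_lattice`):
   `n² · covol(Λ_W) = covol(nΛ_W) = [Λ_{W₂} : nΛ_W] · covol(Λ_{W₂}) = 3 · covol(Λ_{W₂})`.

No Tate's algorithm beyond the tree's tame table, no modularity, no `X₀(N)`-data: the law is purely local-analytic, as
an's MEMO-an §63.3 predicted («THEOREM TARGET, local algebra»).  With the tree edge `covolume_div_three_of_wild_laws`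
(`WildThreeEdgeLaws.lean` §3) the only open input of «`E₀` is the SOURCE of the wild `3`-graph» is now the DATA LAW
E-an-98 `OptimalIsDiscMinimalOnWildThreeEdges` (16 504 / 16 504 edges).  HONEST FRAMING: this is a local theorem about
`3`-isogenies; it proves nothing about BSD, nothing about Manin's conjecture, and does not close C3 — it retires one
typed open obligation of the cell (E-an-97) bearing on stub 5 (RES₃♭ bookkeeping) of line `kato_shift_three`.

References: [GealyKlagsbrun2017] Thm. 1, Prop. 2.1, Cor. 3.2 (arXiv:1703.02148); [DokchitserDokchitser2015LocalInvariants]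
Table 1, Lemma 10 (arXiv:1208.5519); [SilvermanAEC2009] Thm. VI.4.1(b); [SilvermanATAEC1994] IV.9.4 Table 4.1, IV.11.1.
-/

set_option autoImplicit false
-- `Summit.BirchSwinnertonDyer.BirchSwinnertonDyer` is the mandated summit-side namespace (single-conjunct summit).
set_option linter.dupNamespace false

noncomputable section

open scoped Classical

open WeierstrassCurve IsDedekindDomain Rat.HeightOneSpectrum
  Literature.NumberTheory.EllipticCurves Literature.NumberTheory.EllipticCurves.ModularForms
  Literature.NumberTheory.EllipticCurves.Rank1Residual
  Summit.BirchSwinnertonDyer.Rank1Residual.Additive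
  Summit.BirchSwinnertonDyer.Rank1Residual.ManinAdditive.WildThreeEdges

namespace Summit.BirchSwinnertonDyer.BirchSwinnertonDyer.Theorems.ManinLocalTwoThree

/-- **`27 ∣ N(W)` ⟹ `W` is additive and potentially good at `3`** (`0 ≤ ord₃ j`): `9 ∣ N` gives bad, non-multiplicative
reduction (`dvd_conductorNorm_iff_not_hasGoodReductionAtPrime`, `natGenerator_sq_dvd_conductorNorm_iff`), and a
potentially multiplicative additive curve at an odd prime is of type `Iₙ*`, which has `f₃ = 2`, contradicting `27 ∣ N`
(`not_cube_dvd_conductorNorm_of_kodairaSymbolAt_eq_Istar`). [cite: SilvermanATAEC1994, IV.9.4 Table 4.1 and IV.11.1] -/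
theorem padicValRat_three_j_nonneg_of_cube_dvd_conductorNorm (W : WeierstrassCurve ℚ) [W.IsElliptic]
    [W.IsGloballyMinimal] (h27 : 3 ^ 3 ∣ W.conductorNorm ℤ) : 0 ≤ padicValRat 3 W.j := by
  have h9 : 3 ^ 2 ∣ W.conductorNorm ℤ := (pow_dvd_pow 3 (by norm_num : 2 ≤ 3)).trans h27
  have h3 : 3 ∣ W.conductorNorm ℤ := (dvd_pow_self 3 two_ne_zero).trans h9
  have hadd : Addv W 3 := by
    refine ⟨(W.dvd_conductorNorm_iff_not_hasGoodReductionAtPrime 3).mp h3, fun hm ↦ ?_⟩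
    have hmv : W.HasMultiplicativeReductionAt (placeOf 3) :=
      (W.hasMultiplicativeReductionAtPrime_iff_hasMultiplicativeReductionAt_holds ⟨3, Nat.prime_three⟩).mp hm
    have h9' : (natGenerator (placeOf 3)) ^ 2 ∣ W.conductorNorm ℤ := by
      rw [natGenerator_placeOf_eq]; exact h9
    exact hmv.not_hasAdditiveReductionAt ((natGenerator_sq_dvd_conductorNorm_iff (placeOf 3) W).mp h9')
  refine padicValRat_j_nonneg_of_forall_ne_Istar_placeOf W 3 (by decide) hadd fun n hK ↦ ?_
  exact not_cube_dvd_conductorNorm_of_kodairaSymbolAt_eq_Istar W hK h27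

/-- **The Néron scalar of a rational isogeny of degree `3` between globally minimal curves, on prescribed Néron period
pairs, is `±1` or `±3`, with index `3`.**  [cite: SilvermanAEC2009, Thm. VI.4.1(b)]
[cite: DokchitserDokchitser2015LocalInvariants, §4 Lemma 10 (a a' = p)] -/
theorem exists_neronScaling_of_isogeny_degree_three {W W₂ : WeierstrassCurve ℚ} [W.IsElliptic]
    [W₂.IsElliptic] [W.IsGloballyMinimal] [W₂.IsGloballyMinimal] (φ : Isogeny W W₂) (hφ : φ.degree = 3)
    {L L₂ : PeriodPair} (hL : IsNeronLatticeOf (W.baseChange ℂ) L) (hL₂ : IsNeronLatticeOf (W₂.baseChange ℂ) L₂) :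
    ∃ n : ℤ, (∀ z ∈ L.lattice, (n : ℂ) * z ∈ L₂.lattice) ∧
      (L.lattice.toAddSubgroup.map (AddMonoidHom.mulLeft (n : ℂ))).relIndex L₂.lattice.toAddSubgroup = 3 ∧
      n ∣ 3 := by
  obtain ⟨n, hnΛ, hidx⟩ := φ.exists_int_neronScaling_relIndex_eq_degree hL hL₂
  rw [hφ] at hidx
  refine ⟨n, hnΛ, hidx, ?_⟩
  -- `3 Λ₂ ⊆ n Λ`, from the index
  have h3 : ∀ z ∈ L₂.lattice, ∃ y ∈ L.lattice, ((3 : ℤ) : ℂ) * z = ((n : ℚ) : ℂ) * y := by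
    intro z hz
    have hmem : (3 : ℕ) • z ∈ L.lattice.toAddSubgroup.map (AddMonoidHom.mulLeft (n : ℂ)) := by
      rw [← hidx]
      exact AddSubgroup.nsmul_relIndex_mem _ (K := L₂.lattice.toAddSubgroup) hz
    obtain ⟨y, hy, hyz⟩ := AddSubgroup.mem_map.mp hmem
    refine ⟨y, hy, ?_⟩
    rw [AddMonoidHom.coe_mulLeft, nsmul_eq_mul] at hyz
    push_cast at hyz ⊢
    exact hyz.symm
  obtain ⟨k, hk, hk3⟩ := exists_int_eq_and_dvd_of_neronScaling W W₂ L L₂ hL hL₂ (n : ℚ) (n := 3)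
    (by norm_num) (fun y hy ↦ by exact_mod_cast hnΛ y hy) h3
  have hkn : k = n := by exact_mod_cast hk
  exact hkn ▸ hk3

/-- **Covolume bookkeeping**: if `nΛ_W ⊆ Λ_{W₂}` with index `3` (`n ∈ ℤ`, `n ≠ 0`), then
`n² · covol(Λ_W) = 3 · covol(Λ_{W₂})`. [cite: SilvermanAEC2009, Thm. VI.4.1(b)] -/
theorem sq_mul_covolume_eq_three_mul_covolume_of_relIndex_eq_three {L L₂ : PeriodPair} {n : ℤ} (hn : n ≠ 0)
    (hnΛ : ∀ z ∈ L.lattice, (n : ℂ) * z ∈ L₂.lattice)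
    (hidx : (L.lattice.toAddSubgroup.map (AddMonoidHom.mulLeft (n : ℂ))).relIndex L₂.lattice.toAddSubgroup = 3) :
    (n : ℝ) ^ 2 * ZLattice.covolume L.lattice = 3 * ZLattice.covolume L₂.lattice := by
  have hn' : (n : ℂ) ≠ 0 := by exact_mod_cast hn
  -- `nΛ` as a period pair
  have hsub : L.lattice.toAddSubgroup.map (AddMonoidHom.mulLeft (n : ℂ)) =
      (L.mulLeft (n : ℂ) hn').lattice.toAddSubgroup := by
    ext z
    simp only [Submodule.mem_toAddSubgroup, PeriodPair.mem_mulLeft_lattice, AddSubgroup.mem_map,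
      AddMonoidHom.coe_mulLeft]
    constructor
    · rintro ⟨y, hy, rfl⟩
      rwa [inv_mul_cancel_left₀ hn']
    · intro hz
      exact ⟨_, hz, by rw [mul_inv_cancel_left₀ hn']⟩
  have hle : (L.mulLeft (n : ℂ) hn').lattice ≤ L₂.lattice := by
    intro z hz
    have := hnΛ _ (PeriodPair.mem_mulLeft_lattice.mp hz)
    rwa [mul_inv_cancel_left₀ hn'] at this
  have hcov := ZLattice.covolume_div_covolume_eq_relIndex' (L.mulLeft (n : ℂ) hn').lattice L₂.lattice hle
  rw [← hsub, hidx, L.covolume_mulLeft_lattice (n : ℂ) hn',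
    div_eq_iff (ZLattice.covolume_pos L₂.lattice _).ne'] at hcov
  have hnorm : ‖(n : ℂ)‖ ^ 2 = (n : ℝ) ^ 2 := by
    rw [Complex.norm_intCast, sq_abs]
  rw [hnorm] at hcov
  exact_mod_cast hcov

/-- **E-an-97 `ThreeIsogenyCovolumeLawAtWildThree` (PROVED BY NAME).**  For a rational isogeny `φ : W → W₂` of degree
`3` between globally minimal curves with `27 ∣ N(W)` and Néron period pairs `L, L₂`: a RISE of `ord₃ Δ_min` along `φ`
gives `covol(Λ_{W₂}) = covol(Λ_W)/3` (Néron scalar `±1`), a DROP gives `covol(Λ_{W₂}) = 3 · covol(Λ_W)` (Néron scalar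
`±3`).  Gealy–Klagsbrun's direction theorem (tree) at the potentially good prime `3`, plus covolume bookkeeping.
[cite: GealyKlagsbrun2017, Thm. 1, Prop. 2.1 and Cor. 3.2] [cite: DokchitserDokchitser2015LocalInvariants, Table 1] -/
theorem threeIsogenyCovolumeLawAtWildThree_holds : ThreeIsogenyCovolumeLawAtWildThree := by
  intro W W₂ _ _ _ _ φ L L₂ hφ h27 hL hL₂
  obtain ⟨n, hnΛ, hidx, hn3⟩ := exists_neronScaling_of_isogeny_degree_three φ hφ hL hL₂
  have hn0 : n ≠ 0 := by
    rintro rfl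
    exact absurd (zero_dvd_iff.mp hn3) (by norm_num)
  have hj : 0 ≤ padicValRat 3 W.j := padicValRat_three_j_nonneg_of_cube_dvd_conductorNorm W h27
  have hdir := dvd_and_not_dvd_neronScaling_of_padicValInt_minimalDiscriminantInt_lt_of_relIndex_eq W W₂ 3 L L₂ n
    hL hL₂ hnΛ hidx hj
  have hcov := sq_mul_covolume_eq_three_mul_covolume_of_relIndex_eq_three hn0 hnΛ hidx
  -- `n ∣ 3`: `n ∈ {±1, ±3}`
  have hnabs : n.natAbs ∣ 3 := by exact_mod_cast Int.natAbs_dvd_natAbs.mpr hn3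
  have hcases : n.natAbs = 1 ∨ n.natAbs = 3 := (Nat.dvd_prime Nat.prime_three).mp hnabs
  refine ⟨fun hlt ↦ ?_, fun hlt ↦ ?_⟩
  · -- RISE: `3 ∤ n`, so `|n| = 1`
    have hndvd : ¬ ((3 : ℕ) : ℤ) ∣ n := hdir.2 hlt
    have h1 : n.natAbs = 1 := by
      rcases hcases with h | h
      · exact h
      · exact absurd (Int.natAbs_dvd_natAbs.mp (by rw [Int.natAbs_natCast, h])) hndvd
    have hsq : (n : ℝ) ^ 2 = 1 := by
      have : (n.natAbs : ℤ) ^ 2 = n ^ 2 := Int.natAbs_pow_two n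
      have h' : n ^ 2 = 1 := by rw [← this, h1]; norm_num
      exact_mod_cast h'
    rw [hsq, one_mul] at hcov
    linarith
  · -- DROP: `3 ∣ n`, so `|n| = 3`
    have hdvd : ((3 : ℕ) : ℤ) ∣ n := (hdir.1 hlt).1
    have h3 : n.natAbs = 3 := by
      rcases hcases with h | h
      · exfalso
        have h31 : ((3 : ℕ) : ℤ).natAbs ∣ n.natAbs := Int.natAbs_dvd_natAbs.mpr hdvd
        rw [Int.natAbs_natCast, h] at h31
        norm_num at h31
      · exact h
    have hsq : (n : ℝ) ^ 2 = 9 := by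
      have : (n.natAbs : ℤ) ^ 2 = n ^ 2 := Int.natAbs_pow_two n
      have h' : n ^ 2 = 9 := by rw [← this, h3]; norm_num
      exact_mod_cast h'
    rw [hsq] at hcov
    linarith

end Summit.BirchSwinnertonDyer.BirchSwinnertonDyer.Theorems.ManinLocalTwoThree

end
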